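import Summits.QuantumFields.YangMills.Theses.BalabanMarkovExport
import Summits.QuantumFields.YangMills.Theorems.BalabanMarkovExportGlueToolkit
import HarnessLib

/-!
# `BalabanMarkovExport.MarkovExportGlue` (item stmt-QuantumFields-27293, support, provable-now)

`ShellLaw → ConstrainedMarkov → CondResponse → BalabanFamilyExport.FamilyCeilings` — the bookkeeping of the
Markov export line (route BalabanMarkovExport, ideator ym-idea-9 LINE 9).  `L := 13`; a class torus `M = 2·13ᵉ` is
the finest lattice of the family `F = (13, e)` at `K = 0`; for `R ≥ 17` the depth is `k := ⌊log₁₃ (R/17)⌋`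
(`17·13ᵏ ≤ R < 221·13ᵏ`: `k + 2 ≤ e`, window `13ᵏ·uRec ≤ ℓ₄`, separation `34·13ᵏ + 4 ≤ 2R + 4`); `R < 17` is the
sup bound `(2B)ⁿ`.  TOWER STEP (exact): `∏ᵢ (pᵢ − mᵢ) = Σ_S ∏_{i∈S} (pᵢ − hᵢ) ∏_{i∉S} (hᵢ − mᵢ)` with the LOCAL
versions `hᵢ` of `ConstrainedMarkov`; every term with `S ≠ ∅` vanishes, because for `i₀ ∈ S` the other factors
are measurable for (links at block distance `≥ 5` from `x_{i₀}`) `∨ σ(Q_k)` — the other plaquettes sit at block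
distance `≥ 33`, the other annuli `5..16` around blocks `≥ 34` away (`Toolkit.le_tdist_blocks_of_sep`,
`tdist_blocks_add_single_le_one`, `measurable_comap_restrict_plane`, `comap_restrict_mono`); so
`E ∏ᵢ (pᵢ − mᵢ) = E ∏ᵢ (hᵢ − mᵢ)`.  SIZES: `|hᵢ − mᵢ| ≤ ((C + C′)/b⁴)·max(1, (b⁴/C)|hᵢ − gᵢ∘Q_k|)` with the
everywhere-bounded versions `gᵢ` of `CondResponse` (their `σ(Q_k)`-measurability, asked by `ShellLaw`, comes from
`Toolkit.measurable_comap_of_measurable_comp` = Lusin separation), and `ShellLaw` at `Ψ ≡ 1` integrates the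
product of the maxima to `≤ K₀ⁿ`: `|E ∏ᵢ (pᵢ − mᵢ)| ≤ ((C + C′)K₀/b⁴)ⁿ ≤ ((C + C′)K₀·221⁴/R⁴)ⁿ`.

Measure-theoretic bookkeeping (the route's own "provable now" support item). Nothing of E0′ itself, of `ShellLaw` /
`ConstrainedMarkov` / `CondResponse`, of NT or of the gap is proved here; the route is a DRAFT line on the spine
crux `UVSeamRec` (20043); the YM mass gap is NOT proved by any of this.
-/

set_option autoImplicit false

namespace Summit.QuantumFields.YangMills.Theorems.BalabanMarkovExport

open MeasureTheory
open Literature.MathematicalPhysics.QuantumFieldTheory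
open Literature.MathematicalPhysics.QuantumFieldTheory.Balaban1983to89
open Literature.MathematicalPhysics.QuantumFieldTheory.Balaban1983to89.T4Continuum
open Literature.MathematicalPhysics.QuantumLattice (LGConfig torusLift fundamentalLatticeRep)
open Summit.QuantumFields.YangMills.Cruxes.OSLegsFromFemtoAndGap.DlrCollarTransfer (plane)
open Summit.QuantumFields.YangMills.Cruxes.UV.TorusClass (torusEOn MomentBounds6OnSides)
open Summit.QuantumFields.YangMills.Theses.BalabanMarkovExport
open Summit.QuantumFields.YangMills.Theorems.BalabanMarkovExport.Toolkit

/-- **Route item `BalabanMarkovExport.MarkovExportGlue` (stmt-QuantumFields-27293):**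
`ShellLaw → ConstrainedMarkov → CondResponse → BalabanFamilyExport.FamilyCeilings`, by the exact tower step
`E ∏ᵢ (pᵢ − mᵢ) = E ∏ᵢ (hᵢ − mᵢ)` (local versions, Markov separation of the insertions) and the joint shell
stability bound at `Ψ ≡ 1`, at `L := 13`, `K := 0`, `m := e`, depth `k := ⌊log₁₃ (R/17)⌋`. -/
theorem markovExportGlue_proof : MarkovExportGlue := by
  intro hSL hCM hCR
  letI : MeasurableSpace (Matrix.specialUnitaryGroup (Fin 2) ℂ) := borel _
  haveI : BorelSpace (Matrix.specialUnitaryGroup (Fin 2) ℂ) := ⟨rfl⟩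
  obtain ⟨CS, K₀, β₁, ℓ₁, hℓ₁, hCS, hK₀, h₁⟩ := hSL 13 (by decide) (by norm_num)
  have h₃ := hCM 13 (by decide) (by norm_num)
  obtain ⟨CR, β₂, ℓ₂, hℓ₂, hCR0, h₂⟩ := hCR 13 (by decide) (by norm_num)
  obtain ⟨B, hB⟩ :=
    Summit.QuantumFields.YangMills.Cruxes.OSLegsFromFemtoAndGap.DlrCollarTransfer.exists_abs_plane_le
      (G := Matrix.specialUnitaryGroup (Fin 2) ℂ) (fundamentalLatticeRep 2)
  have hB0 : 0 ≤ B := (abs_nonneg _).trans (hB (0, 1) 0 (fun _ => 1))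
  set Cexp : ℝ := (CS + CR) * K₀ * 221 ^ 4 + 2 * B * 16 ^ 4 with hCexp
  have hCexp1 : (CS + CR) * K₀ * 221 ^ 4 ≤ Cexp := by rw [hCexp]; nlinarith
  have hCexp2 : 2 * B * 16 ^ 4 ≤ Cexp := by
    rw [hCexp]; nlinarith [mul_nonneg (add_nonneg hCS.le hCR0) hK₀]
  refine ⟨13, by decide, by norm_num, Cexp, max β₁ β₂, min ℓ₁ ℓ₂, lt_min hℓ₁ hℓ₂,
    hCexp2.trans' (by positivity), ?_⟩
  intro β hβ M instM hM n q x R hq hR hRu hRM hsep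
  obtain ⟨e, he, hMe⟩ := hM
  -- realise the class torus as the finest lattice of the Bałaban family `(L, m) = (13, e)` at `K = 0`
  obtain ⟨F, hFL, hFm⟩ : ∃ F : T4Family, F.L = 13 ∧ F.m = e :=
    ⟨⟨13, ⟨by decide, by norm_num⟩, by norm_num, e, he⟩, rfl, rfl⟩
  have hFM : (F.P 0).sitesPerDir 0 = M := by
    rw [T4Family.sitesPerDir_eq, hFL, hFm, hMe, Nat.add_zero]
  subst hFM
  have hβ₁ : β₁ ≤ β := (le_max_left _ _).trans hβ
  have hβ₂ : β₂ ≤ β := (le_max_right _ _).trans hβ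
  have huR : 0 < Summit.QuantumFields.YangMills.Cruxes.UVSeamRec.Transport.uRec β :=
    Summit.QuantumFields.YangMills.Cruxes.UVSeamRec.UnitTransfer.uRec_pos β
  -- vocabulary
  set Mx : ℕ := (F.P 0).sitesPerDir 0 with hMxdef
  set μ : Measure (GaugeConfig 4 Mx (Matrix.specialUnitaryGroup (Fin 2) ℂ)) :=
    wilsonMeasure (d := 4) (L := Mx) (fundamentalLatticeRep 2).ρ β with hμdef
  set pV : Fin n → GaugeConfig 4 Mx (Matrix.specialUnitaryGroup (Fin 2) ℂ) → ℝ :=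
    fun i V => plane (Matrix.specialUnitaryGroup (Fin 2) ℂ) (fundamentalLatticeRep 2) (q i) (x i)
      (torusLift Mx V) with hpVdef
  set mV : Fin n → ℝ := fun i => torusEOn (Matrix.specialUnitaryGroup (Fin 2) ℂ)
    (fundamentalLatticeRep 2) β Mx
    (plane (Matrix.specialUnitaryGroup (Fin 2) ℂ) (fundamentalLatticeRep 2) (q i) (x i)) with hmVdef
  haveI : IsProbabilityMeasure μ :=
    isProbabilityMeasure_wilsonMeasure (d := 4) (L := Mx) (fundamentalLatticeRep 2).ρ
      (fundamentalLatticeRep 2).continuous β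
  have hpVm : ∀ i, Measurable (pV i) := fun i =>
    (Summit.QuantumFields.YangMills.Cruxes.OSLegsFromFemtoAndGap.DlrCollarTransfer.continuous_plane
      (G := Matrix.specialUnitaryGroup (Fin 2) ℂ) (fundamentalLatticeRep 2) (q i) (x i)).measurable.comp
      (measurable_torusLift (d := 4) (G := Matrix.specialUnitaryGroup (Fin 2) ℂ) Mx)
  have hpVb : ∀ i V, |pV i V| ≤ B := fun i V => hB (q i) (x i) _
  have hint : ∀ (f : GaugeConfig 4 Mx (Matrix.specialUnitaryGroup (Fin 2) ℂ) → ℝ) (A : ℝ),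
      Measurable f → (∀ V, |f V| ≤ A) → Integrable f μ := fun f A hfm hfb => integrable_of_abs_le μ f A hfm hfb
  have hmVb : ∀ i, |mV i| ≤ B := by
    intro i
    change |∫ V, pV i V ∂μ| ≤ B
    calc |∫ V, pV i V ∂μ| ≤ ∫ V, |pV i V| ∂μ := abs_integral_le_integral_abs
      _ ≤ ∫ _V, B ∂μ := integral_mono (hint _ B (hpVm i) (hpVb i)).abs (integrable_const _) fun V => hpVb i V
      _ = B := by simp
  -- the goal is `|∫ ∏ᵢ (pᵢ − mᵢ) dμ| ≤ (Cexp/R⁴)ⁿ` by the definition of `torusEOn`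
  change |∫ V, ∏ i, (pV i V - mV i) ∂μ| ≤ (Cexp / (R : ℝ) ^ 4) ^ n
  have hRpos : (0 : ℝ) < (R : ℝ) := by exact_mod_cast hR
  by_cases hR17 : R < 17
  · -- small collars: the sup bound `(2B)ⁿ ≤ (Cexp/R⁴)ⁿ`
    have hPm : Measurable (fun V => ∏ i, (pV i V - mV i)) :=
      Finset.measurable_prod _ fun i _ => (hpVm i).sub measurable_const
    have hPb : ∀ V, |∏ i, (pV i V - mV i)| ≤ (2 * B) ^ n := fun V => by
      have h := abs_prod_le_pow Finset.univ (fun i V => pV i V - mV i) (2 * B)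
        (fun i V => by have h1 := abs_sub (pV i V) (mV i); linarith [hpVb i V, hmVb i]) V
      rwa [Finset.card_univ, Fintype.card_fin] at h
    have hR16 : (R : ℝ) ^ 4 ≤ 16 ^ 4 := by
      have : (R : ℝ) ≤ 16 := by exact_mod_cast (by omega : R ≤ 16)
      exact pow_le_pow_left₀ hRpos.le this 4
    calc |∫ V, ∏ i, (pV i V - mV i) ∂μ| ≤ ∫ V, |∏ i, (pV i V - mV i)| ∂μ := abs_integral_le_integral_abs
      _ ≤ ∫ _V, (2 * B) ^ n ∂μ :=
          integral_mono (hint _ _ hPm hPb).abs (integrable_const _) fun V => hPb V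
      _ = (2 * B) ^ n := by simp
      _ ≤ (Cexp / (R : ℝ) ^ 4) ^ n := by
          refine pow_le_pow_left₀ (by positivity) ?_ n
          rw [le_div_iff₀ (by positivity)]
          calc 2 * B * (R : ℝ) ^ 4 ≤ 2 * B * 16 ^ 4 := mul_le_mul_of_nonneg_left hR16 (by positivity)
            _ ≤ Cexp := hCexp2
  · -- `R ≥ 17`: the depth `k = ⌊log₁₃ (R / 17)⌋`
    push Not at hR17
    obtain ⟨k, hk1, hk2⟩ : ∃ k : ℕ, 17 * 13 ^ k ≤ R ∧ R < 221 * 13 ^ k := by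
      refine ⟨Nat.log 13 (R / 17), ?_, ?_⟩
      · have h17 : R / 17 ≠ 0 := by omega
        have := Nat.pow_log_le_self 13 h17; omega
      · have := Nat.lt_pow_succ_log_self (b := 13) (by norm_num) (R / 17)
        rw [pow_succ] at this; omega
    have hke : k + 2 ≤ F.m + 0 := by
      rw [hFm, Nat.add_zero]
      have h13 : 13 ^ (k + 1) < 13 ^ e := by
        have := hMe; rw [pow_succ]; omega
      have := (Nat.pow_lt_pow_iff_right (by norm_num : 1 < 13)).1 h13
      omega
    have hkm : k ≤ F.m := by omega
    have h13R : ((13 : ℕ) : ℝ) ^ k ≤ (R : ℝ) := by exact_mod_cast (show 13 ^ k ≤ R by omega)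
    have hb₁ : ((13 : ℕ) : ℝ) ^ k * Summit.QuantumFields.YangMills.Cruxes.UVSeamRec.Transport.uRec β ≤ ℓ₁ :=
      (mul_le_mul_of_nonneg_right h13R huR.le).trans (hRu.trans (min_le_left _ _))
    have hb₂ : ((13 : ℕ) : ℝ) ^ k * Summit.QuantumFields.YangMills.Cruxes.UVSeamRec.Transport.uRec β ≤ ℓ₂ :=
      (mul_le_mul_of_nonneg_right h13R huR.le).trans (hRu.trans (min_le_right _ _))
    set b4 : ℝ := (((13 : ℕ) : ℝ) ^ k) ^ 4 with hb4def
    have hb4 : 0 < b4 := by positivity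
    -- the block map `Q_k`, the block-field σ-algebra and the link σ-algebras of the route statement
    set Q : GaugeConfig 4 Mx (Matrix.specialUnitaryGroup (Fin 2) ℂ) →
        GaugeField (F.P 0) k (Matrix.specialUnitaryGroup (Fin 2) ℂ) :=
      fun V => Averaging.iter (fun j => BlockAveraging.blockAvg (P := F.P 0) (j := j) su2Mean) k
        (ofConfig (P := F.P 0) (j := 0) V) with hQdef
    have hQm : Measurable Q :=
      (T4Continuum.measurable_iter (fun j => BlockAveraging.blockAvg (P := F.P 0) (j := j) su2Mean)
        (fun j => BlockAveraging.measurable_avgFun su2Mean measurable_su2Mean_E) k).comp measurable_ofConfig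
    haveI : NeZero ((F.P 0).sitesPerDir k) := ⟨Params.sitesPerDir_ne_zero _ _⟩
    set cb : (Fin 4 → ZMod Mx) → Site (F.P 0) k :=
      fun s ν => ((((s ν).val / F.L ^ k : ℕ)) : ZMod ((F.P 0).sitesPerDir k)) with hcbdef
    set cs : (Fin 4 → ℤ) → Site (F.P 0) k := fun x => cb (fun ν => ((x ν : ℤ) : ZMod Mx)) with hcsdef
    set lk : (Fin 4 → ℤ) → ℕ → ℕ → Set (Edge 4 Mx) :=
      fun x r₁ r₂ => {e | r₁ ≤ Site.tdist (cb e.1) (cs x) ∧ Site.tdist (cb e.1) (cs x) ≤ r₂} with hlkdef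
    set ext : (Fin 4 → ℤ) → Set (Edge 4 Mx) := fun x => {e | 5 ≤ Site.tdist (cb e.1) (cs x)} with hextdef
    -- (the σ-algebras `mOn S`, `mQ` of the route statement are written out: a local binding would be an instance)
    have hmOn_le : ∀ S : Set (Edge 4 Mx), (MeasurableSpace.comap (fun V : GaugeConfig 4 Mx (Matrix.specialUnitaryGroup (Fin 2) ℂ) => (S).restrict V) inferInstance) ≤ (MeasurableSpace.pi : MeasurableSpace
        (GaugeConfig 4 Mx (Matrix.specialUnitaryGroup (Fin 2) ℂ))) :=
      fun S => by
        have hres : Measurable (fun V : GaugeConfig 4 Mx (Matrix.specialUnitaryGroup (Fin 2) ℂ) =>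
            S.restrict V) :=
          measurable_pi_lambda _ fun e : S => measurable_pi_apply (e.1 : Edge 4 Mx)
        exact hres.comap_le
    have hmQ_le : MeasurableSpace.comap Q inferInstance ≤ (MeasurableSpace.pi : MeasurableSpace
        (GaugeConfig 4 Mx (Matrix.specialUnitaryGroup (Fin 2) ℂ))) := hQm.comap_le
    -- CondResponse: everywhere-bounded versions `gᵢ` of `E[pᵢ | Q_k]`
    have hg : ∀ i : Fin n, ∃ g : GaugeField (F.P 0) k (Matrix.specialUnitaryGroup (Fin 2) ℂ) → ℝ,
        Measurable (fun V => g (Q V)) ∧ (∀ W, |g W - mV i| ≤ CR / b4) ∧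
        ∀ φ : GaugeField (F.P 0) k (Matrix.specialUnitaryGroup (Fin 2) ℂ) → ℝ,
          Measurable (fun V => φ (Q V)) → (∀ W, |φ W| ≤ 1) →
          ∫ V, (pV i V - g (Q V)) * φ (Q V) ∂μ = 0 :=
      fun i => h₂ β hβ₂ F 0 k hFL (by omega) hb₂ (q i) (x i) (hq i)
    choose g hgm hgb hgo using hg
    -- ConstrainedMarkov: local versions `hᵢ` of `E[pᵢ | ext_i ∨ Q_k]`
    have hh' : ∀ i : Fin n, ∃ hh : GaugeConfig 4 Mx (Matrix.specialUnitaryGroup (Fin 2) ℂ) → ℝ,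
        (∃ D : ℝ, ∀ V, |hh V| ≤ D) ∧ Measurable[(MeasurableSpace.comap (fun V : GaugeConfig 4 Mx (Matrix.specialUnitaryGroup (Fin 2) ℂ) => (lk (x i) 5 16).restrict V) inferInstance) ⊔ MeasurableSpace.comap Q inferInstance] hh ∧
        ∀ Γ : GaugeConfig 4 Mx (Matrix.specialUnitaryGroup (Fin 2) ℂ) → ℝ,
          Measurable[(MeasurableSpace.comap (fun V : GaugeConfig 4 Mx (Matrix.specialUnitaryGroup (Fin 2) ℂ) => (ext (x i)).restrict V) inferInstance) ⊔ MeasurableSpace.comap Q inferInstance] Γ → (∀ V, |Γ V| ≤ 1) → ∫ V, (pV i V - hh V) * Γ V ∂μ = 0 :=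
      fun i => h₃ β F 0 k hFL hke (q i) (x i) (hq i)
    choose hh hhb hhm hho using hh'
    choose D hD using hhb
    have hD0 : ∀ i, 0 ≤ D i := fun i => (abs_nonneg _).trans (hD i (fun _ => 1))
    have hhm' : ∀ i, Measurable (hh i) := fun i =>
      (hhm i).mono (sup_le (hmOn_le _) hmQ_le) le_rfl
    -- BLOCK GEOMETRY: separated insertions have far blocks; plaquette links sit next to their block
    have hL0 : 0 < F.L ^ k := pow_pos (by rw [hFL]; norm_num) k
    have hMxN : Mx = F.L ^ k * (F.P 0).sitesPerDir k := by
      have h1 : F.L ^ F.m = F.L ^ k * F.L ^ (F.m - k) := by rw [← pow_add, Nat.add_sub_cancel' hkm]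
      show 2 * F.L ^ (F.m + 0 - 0) = F.L ^ k * (2 * F.L ^ (F.m + 0 - k))
      simp only [Nat.add_zero, Nat.sub_zero, h1]; ring
    -- separated insertions have blocks at `ℓ¹` distance `≥ 34`
    have hsep34 : ∀ i j : Fin n, i ≠ j → ∃ κ : Fin 4,
        (34 * ((13 : ℕ) : ℤ) ^ k + 4) ≤ |((((x i κ - x j κ : ℤ) : ZMod Mx)).valMinAbs : ℤ)| := by
      intro i j hij
      obtain ⟨κ, hκ⟩ := hsep i j hij
      refine ⟨κ, le_trans ?_ hκ⟩
      have : (17 : ℤ) * 13 ^ k ≤ R := by exact_mod_cast hk1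
      push_cast; linarith
    have hfar : ∀ i j : Fin n, i ≠ j → 34 ≤ Site.tdist (cs (x i)) (cs (x j)) := by
      intro i j hij
      obtain ⟨κ, hκ⟩ := hsep34 i j hij
      have h1 : (((x i κ : ℤ) : ZMod Mx) - ((x j κ : ℤ) : ZMod Mx)) = (((x i κ - x j κ : ℤ)) : ZMod Mx) := by
        push_cast; ring
      rw [Int.abs_eq_natAbs] at hκ
      refine le_tdist_blocks_of_sep (P := F.P 0) hMxN hL0 _ _ κ ?_
      rw [h1, hFL]
      exact_mod_cast hκ
    -- a link of a plaquette sits next to the plaquette's block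
    have hnear : ∀ (j : Fin n) (i' : Fin 4),
        Site.tdist (cb (Literature.MathematicalPhysics.QuantumFieldTheory.Site.shift
          (Literature.Probability.LatticeModels.Torus.proj Mx (x j)) i')) (cs (x j)) ≤ 1 :=
      fun j i' => tdist_blocks_add_single_le_one (P := F.P 0) hMxN hL0 _ i'
    -- links within block distance `16` of the block of `x j` are exterior for `x i` (`i ≠ j`)
    have hnearfar : ∀ i j : Fin n, i ≠ j → ∀ (s : Fin 4 → ZMod Mx), Site.tdist (cb s) (cs (x j)) ≤ 16 →
        5 ≤ Site.tdist (cb s) (cs (x i)) := by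
      intro i j hij s hs
      have h1 := hfar j i hij.symm
      have h2 := B3Taylor310LocalRemainder.tdist_triangle (cs (x j)) (cb s) (cs (x i))
      rw [B3Taylor310LocalRemainder.tdist_comm (cs (x j)) (cb s)] at h2
      omega
    have hedge : ∀ i j : Fin n, i ≠ j → ∀ (s : Fin 4 → ZMod Mx), Site.tdist (cb s) (cs (x j)) ≤ 1 →
        ∀ d : Fin 4, ((s, d) : Edge 4 Mx) ∈ ext (x i) :=
      fun i j hij s hs d => hnearfar i j hij s (hs.trans (by norm_num))
    have hlkext : ∀ i j : Fin n, i ≠ j → lk (x j) 5 16 ⊆ ext (x i) :=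
      fun i j hij e he => hnearfar i j hij e.1 he.2
    -- measurability of the OTHER insertions' factors in `σ(links of ext_i) ∨ σ(Q_k)`
    have hp_ext : ∀ i j : Fin n, i ≠ j → Measurable[(MeasurableSpace.comap (fun V : GaugeConfig 4 Mx (Matrix.specialUnitaryGroup (Fin 2) ℂ) => (ext (x i)).restrict V) inferInstance) ⊔ MeasurableSpace.comap Q inferInstance] (pV j) := by
      intro i j hij
      have hs0 : Site.tdist (cb (Literature.Probability.LatticeModels.Torus.proj Mx (x j))) (cs (x j)) ≤ 1 := by
        have : Site.tdist (cs (x j)) (cs (x j)) = 0 := B3Taylor310LocalRemainder.tdist_self _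
        change Site.tdist (cs (x j)) (cs (x j)) ≤ 1
        omega
      have hm := measurable_comap_restrict_plane (fundamentalLatticeRep 2) Mx (q j) (x j) (ext (x i))
        (hedge i j hij _ hs0 _) (hedge i j hij _ (hnear j _) _) (hedge i j hij _ (hnear j _) _)
        (hedge i j hij _ hs0 _)
      exact hm.mono le_sup_left le_rfl
    have hh_ext : ∀ i j : Fin n, i ≠ j → Measurable[(MeasurableSpace.comap (fun V : GaugeConfig 4 Mx (Matrix.specialUnitaryGroup (Fin 2) ℂ) => (ext (x i)).restrict V) inferInstance) ⊔ MeasurableSpace.comap Q inferInstance] (hh j) := fun i j hij =>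
      (hhm j).mono (sup_le_sup_right (comap_restrict_mono (hlkext i j hij)) _) le_rfl
    -- THE TOWER STEP: `E ∏ᵢ (pᵢ − mᵢ) = E ∏ᵢ (hᵢ − mᵢ)`
    classical
    set Kb : ℝ := 2 * B + ∑ i, D i + 1 with hKb
    have hDs : ∀ i, D i ≤ ∑ j, D j := fun i =>
      Finset.single_le_sum (f := D) (fun j _ => hD0 j) (Finset.mem_univ i)
    have hKb0 : 0 < Kb := by
      have := Finset.sum_nonneg (fun i (_ : i ∈ (Finset.univ : Finset (Fin n))) => hD0 i)
      rw [hKb]; linarith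
    have hfb : ∀ i V, |pV i V - hh i V| ≤ Kb := by
      intro i V
      have h1 := abs_sub (pV i V) (hh i V)
      linarith [hpVb i V, hD i V, hDs i]
    have hgb' : ∀ i V, |hh i V - mV i| ≤ Kb := by
      intro i V
      have h1 := abs_sub (hh i V) (mV i)
      linarith [hmVb i, hD i V, hDs i]
    have hprodb : ∀ (S : Finset (Fin n))
        (f : Fin n → GaugeConfig 4 Mx (Matrix.specialUnitaryGroup (Fin 2) ℂ) → ℝ),
        (∀ i V, |f i V| ≤ Kb) → ∀ V, |∏ i ∈ S, f i V| ≤ Kb ^ S.card := fun S f hf V => abs_prod_le_pow S f Kb hf V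
    have hexp : (fun V => ∏ i, (pV i V - mV i)) = fun V => ∑ S ∈ (Finset.univ : Finset (Fin n)).powerset,
        (∏ i ∈ S, (pV i V - hh i V)) * ∏ i ∈ Finset.univ \ S, (hh i V - mV i) := by
      funext V
      have h1 : ∏ i, (pV i V - mV i) = ∏ i, ((pV i V - hh i V) + (hh i V - mV i)) :=
        Finset.prod_congr rfl fun i _ => by ring
      rw [h1, Finset.prod_add]
    have hTint : ∀ S : Finset (Fin n), Integrable (fun V => (∏ i ∈ S, (pV i V - hh i V)) *
        ∏ i ∈ Finset.univ \ S, (hh i V - mV i)) μ :=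
      fun S => hint _ (Kb ^ S.card * Kb ^ (Finset.univ \ S).card)
        ((Finset.measurable_prod _ fun i _ => (hpVm i).sub (hhm' i)).mul
          (Finset.measurable_prod _ fun i _ => (hhm' i).sub measurable_const))
        fun V => by
          rw [abs_mul]
          exact mul_le_mul (hprodb S _ hfb V) (hprodb _ _ hgb' V) (abs_nonneg _) (pow_nonneg hKb0.le _)
    -- every term with `S ≠ ∅` vanishes: local orthogonality at some `i₀ ∈ S`
    have hvanish : ∀ S ∈ (Finset.univ : Finset (Fin n)).powerset, S ≠ ∅ →
        ∫ V, (∏ i ∈ S, (pV i V - hh i V)) * ∏ i ∈ Finset.univ \ S, (hh i V - mV i) ∂μ = 0 := by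
      intro S _ hne
      obtain ⟨i₀, hi₀⟩ := Finset.nonempty_iff_ne_empty.2 hne
      set N1 : ℕ := (S.erase i₀).card + (Finset.univ \ S).card with hN1
      have hK : Kb ^ N1 ≠ 0 := pow_ne_zero _ hKb0.ne'
      set Γ : GaugeConfig 4 Mx (Matrix.specialUnitaryGroup (Fin 2) ℂ) → ℝ := fun V =>
        ((∏ i ∈ S.erase i₀, (pV i V - hh i V)) * ∏ i ∈ Finset.univ \ S, (hh i V - mV i)) / Kb ^ N1
        with hΓ
      have hΓm : Measurable[(MeasurableSpace.comap (fun V : GaugeConfig 4 Mx (Matrix.specialUnitaryGroup (Fin 2) ℂ) => (ext (x i₀)).restrict V) inferInstance) ⊔ MeasurableSpace.comap Q inferInstance] Γ := by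
        refine ((Finset.measurable_prod _ fun i hi => ?_).mul
          (Finset.measurable_prod _ fun i hi => ?_)).div_const _
        · have hne' : i ≠ i₀ := Finset.ne_of_mem_erase hi
          exact (hp_ext i₀ i hne'.symm).sub (hh_ext i₀ i hne'.symm)
        · have hne' : i ≠ i₀ := by
            intro h; rw [h] at hi; exact (Finset.mem_sdiff.1 hi).2 hi₀
          exact (hh_ext i₀ i hne'.symm).sub measurable_const
      have hΓb : ∀ V, |Γ V| ≤ 1 := by
        intro V
        rw [hΓ, abs_div, abs_of_pos (pow_pos hKb0 _), div_le_one (pow_pos hKb0 _), abs_mul, hN1, pow_add]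
        exact mul_le_mul (hprodb _ _ hfb V) (hprodb _ _ hgb' V) (abs_nonneg _) (pow_nonneg hKb0.le _)
      have horth := hho i₀ Γ hΓm hΓb
      have hsplit : (fun V => (∏ i ∈ S, (pV i V - hh i V)) * ∏ i ∈ Finset.univ \ S, (hh i V - mV i)) =
          fun V => Kb ^ N1 * ((pV i₀ V - hh i₀ V) * Γ V) := by
        funext V
        rw [← Finset.mul_prod_erase S (fun i => pV i V - hh i V) hi₀, hΓ]
        field_simp
      rw [hsplit, integral_const_mul, horth, mul_zero]
    -- hence only `S = ∅` survives
    have hI : ∫ V, ∏ i, (pV i V - mV i) ∂μ = ∫ V, ∏ i, (hh i V - mV i) ∂μ := by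
      rw [hexp, integral_finsetSum _ (fun S _ => hTint S),
        Finset.sum_eq_single_of_mem ∅ (Finset.empty_mem_powerset _) (fun S hS hne => hvanish S hS hne)]
      congr 1
      funext V
      simp
    -- SIZES: `|hᵢ − mᵢ| ≤ ((CS + CR)/b⁴) · max 1 ((b⁴/CS)|hᵢ − gᵢ∘Q_k|)`
    set Mf : Fin n → GaugeConfig 4 Mx (Matrix.specialUnitaryGroup (Fin 2) ℂ) → ℝ :=
      fun i V => max 1 ((b4 / CS) * |hh i V - g i (Q V)|) with hMf
    have hMf1 : ∀ i V, 1 ≤ Mf i V := fun i V => le_max_left _ _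
    have hgB : ∀ i W, |g i W| ≤ |mV i| + CR / b4 := by
      intro i W
      have h1 := hgb i W
      have h2 := abs_sub_abs_le_abs_sub (g i W) (mV i)
      linarith
    have hdom : ∀ i V, |hh i V - mV i| ≤ ((CS + CR) / b4) * Mf i V := by
      intro i V
      have h1 : |hh i V - g i (Q V)| ≤ (CS / b4) * Mf i V := by
        have h2 : (b4 / CS) * |hh i V - g i (Q V)| ≤ Mf i V := le_max_right _ _
        have h3 : (CS / b4) * ((b4 / CS) * |hh i V - g i (Q V)|) = |hh i V - g i (Q V)| := by
          field_simp
        calc |hh i V - g i (Q V)| = (CS / b4) * ((b4 / CS) * |hh i V - g i (Q V)|) := h3.symm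
          _ ≤ (CS / b4) * Mf i V := mul_le_mul_of_nonneg_left h2 (by positivity)
      have h4 : |g i (Q V) - mV i| ≤ CR / b4 := hgb i (Q V)
      have h5 : CR / b4 ≤ (CR / b4) * Mf i V := le_mul_of_one_le_right (by positivity) (hMf1 i V)
      calc |hh i V - mV i| ≤ |hh i V - g i (Q V)| + |g i (Q V) - mV i| := abs_sub_le _ _ _
        _ ≤ (CS / b4) * Mf i V + (CR / b4) * Mf i V := add_le_add h1 (h4.trans h5)
        _ = ((CS + CR) / b4) * Mf i V := by ring
    have hMfm : ∀ i, Measurable (Mf i) := fun i =>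
      measurable_const.max ((continuous_abs.measurable.comp ((hhm' i).sub (hgm i))).const_mul _)
    set Mb : Fin n → ℝ := fun i => 1 + (b4 / CS) * (D i + (|mV i| + CR / b4)) with hMb
    have hMfb : ∀ i V, |Mf i V| ≤ Mb i := by
      intro i V
      rw [abs_of_nonneg (le_trans zero_le_one (hMf1 i V))]
      have h1 : |hh i V - g i (Q V)| ≤ D i + (|mV i| + CR / b4) := by
        have := abs_sub (hh i V) (g i (Q V))
        linarith [hD i V, hgB i (Q V)]
      have h2 : 0 ≤ (b4 / CS) * (D i + (|mV i| + CR / b4)) :=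
        mul_nonneg (div_nonneg hb4.le hCS.le) (add_nonneg (hD0 i) (add_nonneg (abs_nonneg _) (div_nonneg hCR0 hb4.le)))
      refine max_le (by linarith) ?_
      have := mul_le_mul_of_nonneg_left h1 (show 0 ≤ b4 / CS by positivity)
      linarith
    -- ShellLaw at `Ψ ≡ 1`
    have hbd : ∀ i, ∃ D' : ℝ, (∀ W, |g i W| ≤ D') ∧ (∀ V, |hh i V| ≤ D') := fun i =>
      ⟨max (|mV i| + CR / b4) (D i), fun W => (hgB i W).trans (le_max_left _ _),
        fun V => (hD i V).trans (le_max_right _ _)⟩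
    -- `ShellLaw` asks `σ(Q_k)`-measurability of the versions (its hypotheses live under the local instance `mQ`):
    -- Lusin separation upgrades the ambient measurability of `gᵢ ∘ Q_k`
    have hgmQ : ∀ i, Measurable[MeasurableSpace.comap Q inferInstance] (fun V => g i (Q V)) := fun i =>
      measurable_comap_of_measurable_comp hQm (hgm i)
    have hgoQ : ∀ i, ∀ φ : GaugeField (F.P 0) k (Matrix.specialUnitaryGroup (Fin 2) ℂ) → ℝ,
        Measurable[MeasurableSpace.comap Q inferInstance] (fun V => φ (Q V)) → (∀ W, |φ W| ≤ 1) →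
        ∫ V, (pV i V - g i (Q V)) * φ (Q V) ∂μ = 0 :=
      fun i φ hφ hφb => hgo i φ (hφ.mono hmQ_le le_rfl) hφb
    have key : ∫ V, (∏ i, Mf i V) *
        |(fun _ : GaugeField (F.P 0) k (Matrix.specialUnitaryGroup (Fin 2) ℂ) => (1 : ℝ)) (Q V)| ∂μ ≤
        K₀ ^ n * ∫ V, |(fun _ : GaugeField (F.P 0) k (Matrix.specialUnitaryGroup (Fin 2) ℂ) => (1 : ℝ)) (Q V)| ∂μ :=
      h₁ β hβ₁ F 0 k hFL hke hb₁ n q x hq hsep34 g hh hbd hgmQ hhm hgoQ hho (fun _ => 1) measurable_const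
        (fun _ => by simp)
    have key' : ∫ V, ∏ i, Mf i V ∂μ ≤ K₀ ^ n := by simpa using key
    -- conclusion
    have hPhm : Measurable (fun V => ∏ i, (hh i V - mV i)) :=
      Finset.measurable_prod _ fun i _ => (hhm' i).sub measurable_const
    have hMfint : Integrable (fun V => ∏ i, Mf i V) μ :=
      hint _ (∏ i, Mb i) (Finset.measurable_prod _ fun i _ => hMfm i) fun V => by
        rw [Finset.abs_prod]
        exact Finset.prod_le_prod (fun i _ => abs_nonneg _) fun i _ => hMfb i V
    calc |∫ V, ∏ i, (pV i V - mV i) ∂μ| = |∫ V, ∏ i, (hh i V - mV i) ∂μ| := by rw [hI]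
      _ ≤ ∫ V, |∏ i, (hh i V - mV i)| ∂μ := abs_integral_le_integral_abs
      _ ≤ ∫ V, ((CS + CR) / b4) ^ n * ∏ i, Mf i V ∂μ := by
          refine integral_mono (hint _ _ hPhm (hprodb _ _ hgb')).abs (hMfint.const_mul _) fun V => ?_
          change |∏ i, (hh i V - mV i)| ≤ ((CS + CR) / b4) ^ n * ∏ i, Mf i V
          rw [Finset.abs_prod]
          calc ∏ i, |hh i V - mV i| ≤ ∏ i, (((CS + CR) / b4) * Mf i V) :=
                Finset.prod_le_prod (fun i _ => abs_nonneg _) fun i _ => hdom i V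
            _ = ((CS + CR) / b4) ^ n * ∏ i, Mf i V := by
                rw [Finset.prod_mul_distrib, Finset.prod_const, Finset.card_univ, Fintype.card_fin]
      _ = ((CS + CR) / b4) ^ n * ∫ V, ∏ i, Mf i V ∂μ := integral_const_mul _ _
      _ ≤ ((CS + CR) / b4) ^ n * K₀ ^ n := mul_le_mul_of_nonneg_left key' (by positivity)
      _ = ((CS + CR) * K₀ / b4) ^ n := by rw [← mul_pow]; ring
      _ ≤ (Cexp / (R : ℝ) ^ 4) ^ n := by
          refine pow_le_pow_left₀ (by positivity) ?_ n
          have hR4 : (R : ℝ) ^ 4 ≤ 221 ^ 4 * b4 := by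
            rw [hb4def, ← mul_pow]
            exact pow_le_pow_left₀ hRpos.le (by exact_mod_cast hk2.le) 4
          rw [div_le_div_iff₀ hb4 (by positivity)]
          calc (CS + CR) * K₀ * (R : ℝ) ^ 4 ≤ (CS + CR) * K₀ * (221 ^ 4 * b4) :=
                mul_le_mul_of_nonneg_left hR4 (mul_nonneg (add_nonneg hCS.le hCR0) hK₀)
            _ = ((CS + CR) * K₀ * 221 ^ 4) * b4 := by ring
            _ ≤ Cexp * b4 := mul_le_mul_of_nonneg_right hCexp1 hb4.le

end Summit.QuantumFields.YangMills.Theorems.BalabanMarkovExport
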